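/-
Copyright (c) 2026 the pub-hodgecm-mathlib formalisation cell (harness21).  Prover seat hodgecm-mathlib-LH7-p09 (g2), CLOSE-OUT ROSTER strike line L3∕L5 (Track A
«(D-RAM) FOUR-FRAME» squad F0∕P3c∕LH4 ∕ F0∕P3c∕LH7); β₂-BOARD v2 row (OFF) (lead LH7-p09 (g2); assembler LH4-p12 (g8) ED. 4 `…OffRowOfPiecesParity`, socket `hL`);
helper lane on h413 = stmt-HodgeConjecture-24833 (count-neutral).  2026-09-04∕05.
-/
import Summits.HodgeConjecture.HodgeConjecture.Theorems.F0P3cDyRamDeepConeCellOffShellLevel     -- ★ p863123 (this seat): level `L` of a deep-by-`L` cell, the anti-diagonal digit; brings ★ `…ShellLineModel`, ★ p862572 coordinates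
import HarnessLib

/-!
# Crux `H413`, line LH4 «(D-RAM) FOUR-FRAME» — the (β₂) road (R-36), β₂-BOARD v2 row (OFF), socket `hL`: «THE LOWER LINE IS ON BOTH SHELLS» — a POSITIVE square token
# from the level token and sizes (any cell, any `q`, any `d`), and on the lower line `j + b + ℓ₀ = jl′` (`2b + ℓ₀ < m₀`, `b < j`) every glued vertex lies on the
# near-transvection shell `(ℓ₀, m̃)` for EVERY square level `m̃ = ℓ₀ + k` with `|μ| ≤ |ϖE|^k`, `|u₀₀ − 1| ≤ |ϖ|^k` — so for both `m*` and `m_c` at once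

Cell `hodgecm-mathlib` (D-0151), FLOOR 0, crux item H413 = `stmt-HodgeConjecture-24833`, route of record `HCCMUnconditional`; squads F0∕P3c∕LH4 ∕ LH7; lane
`--supports stmt-HodgeConjecture-24833 --as helper` (count-neutral; pays NO tier-0 row).  THEOREMS ONLY (no `def`, no instance, no notation, no `sorry`, default heartbeats);
★-only imports; states NO law; (β₂) stays a HYPOTHESIS.  DATUM-FREE: line model `(M, jE, ρ, α)` and ★ `…ShellLineModel`'s glued-vertex letters VERBATIM, as in ★ p862651 ∕
★ p863123.  NO residue field, NO `|2|`, NO `σ`.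

WHY ((OFF) socket `hL` of LH4-p12 (g8)'s ED. 4 `cellDiff_offRow_eq_zero_of_pieces₄`; LH4-p19 (g2)'s (S3) «both shells on D»; LH4-p13 (g9)'s (U) bands).  The two literals of a
cone cell's `cellDiff(j, b)` carry the shell conjuncts `LatticeNearTransvShell ϖ ℓ₀ m* (Γ − 1) L₃` (label `+`) and `LatticeNearTransvShell ϖ ℓ₀ m_c (Γ − 1) L₃` (label `−′`), which
differ ONLY in the square level.  ★ `…ShellLineModel.latticeInLevel_endoGL_sub_one_sq_iff_isOrd` reads the square token `(Γ − 1)²·L₃ ⊆ ϖ^{m̃}·L₃` as three clauses: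
`|(u₀₀ − 1)²| ≤ |ϖ^{m̃}|`, `(lam − 1)²∕ϖE^{m̃} ∈ 𝒪_cc`, `((lam − 1)² − (jE u₀₀ − 1)²)∕(ϖE^{m̃}·Y) ∈ 𝒪_cc`.  Writing `m̃ = ℓ₀ + k`, `w = lam − 1`, `t = jE u₀₀ − 1 ∈ Fix ρ`,
`μ = w − t`, each clause FACTORS as (a level-`ℓ₀` token) × (a `k`-small element): `w²∕ϖE^{m̃} = (w∕ϖE^{ℓ₀})·(w∕ϖE^k)` and `(w² − t²)∕(ϖE^{m̃}Y) = (μ∕(ϖE^{ℓ₀}Y))·((μ + 2t)∕ϖE^k)`,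
and an order element `x` times ANY `y` with `|y| ≤ 1` stays in the order as soon as `|x|·|y − ρy| ≤ |cc(α − ρα)|` (§1 `isOrd_mul_of_v_mul_sub_map_le`: `xy − ρ(xy) =
(x − ρx)y + ρx(y − ρy)`).  For the third clause `|x|·|y − ρy| = |μ|·|μ − ρμ|∕(|ϖE|^{m̃}·|Y|)`, whence the ONE product letter `|μ|·|μ − ρμ| ≤ |cc(α − ρα)|·|Y|·|ϖE|^{m̃}`
(`m₀ + jl′ ≥ j + b + m̃` in depths).  This is the positive sibling of ★ `…TopConeCellOffShell` (LH4-p13 (g9): above the row the same clause FAILS when `jl′ + m₀ < j + b + m̃`):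
on the upper line `j − b = jl′ − m₀` the letter reads `2(m₀ − b) ≥ m̃` (the `hUlo` band), on the diagonal row cell `(b, b)` it reads `jl′ + ℓ₀ ≥ m̃`, and on the LOWER LINE
`j + b + ℓ₀ = jl′` it reads `m₀ + ℓ₀ ≥ m̃` — true for both `m*` and `m_c` once `N₀ ≥ m_c`.
* §1 `isOrd_mul_of_v_mul_sub_map_le`; `isOrd_sq_div_pow_of_isOrd_div_pow` (clause 2); `isOrd_mul_div_pow_mul_of_isOrd_div_pow_mul` (clause 3); HEAD
  **`latticeInLevel_sq_endoGL_sub_one_of_level`**: `LatticeInLevel ϖ ℓ₀ (Γ − 1) L₃`, `ℓ₀ + k = m̃`, `|u₀₀ − 1| ≤ |ϖ^k|`, `|μ| ≤ |ϖE|^k`, the product letter ⇒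
  `LatticeInLevel ϖ m̃ ((Γ − 1)(Γ − 1)) L₃`.
* §2 THE LOWER LINE SITS ON LEVEL EXACTLY `ℓ₀` AND ON EVERY SQUARE LEVEL: `not_isOrd_div_pow_succ_mul_of_line` (★ p863123 §3's digit at a general `ℓ₀`: `|μ| ≤ |ϖE|^{2b+ℓ₀+1}`,
  `|μ − ρμ| = |cc(α − ρα)|·|ϖE|^{b+ℓ₀}` EXACTLY, `|cc| < |ϖE|^b` ⇒ `μ∕(ϖE^{ℓ₀+1}·Y) ∉ 𝒪_cc`), HEAD `not_latticeInLevel_succ_endoGL_sub_one_of_line`, and HEAD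
  **`latticeNearTransvShell_of_line`**: `LatticeNearTransvShell ϖ ℓ₀ m̃ (Γ − 1) L₃` for every glued vertex over a lower-line cell (level `ℓ₀` = ★ p863123
  `latticeInLevel_endoGL_sub_one_of_deep_level (L := ℓ₀)`; not level `ℓ₀ + 1` = the digit; square level = §1 with the product letter discharged from the line's two size letters).
CONSEQUENCE (for the `hL` assembly, FILE 8): on the lower line BOTH shell conjuncts of ED. 4's two literals are TRUE, so `cellDiff(j, b) = 0` there is the pure LABEL balance
«`Σ_{Λ: VS_{m*} = V₊} f = Σ_{Λ: VS_{m*} ≠ V₊} f`» — the `m*`∕`m_c` asymmetry of the literals is gone.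
WHAT IS NOT CLAIMED.  Any label law, any count, the balance itself; which square levels the ROW or the UPPER line carry beyond the sufficient condition of §1.
HONEST LABEL.  Count-neutral valuation algebra; nothing printed is asserted; no census law is stated; `HC_CM` is proved only modulo the 7 printed citations (2 remaining named inputs:
hLiu418 = `stmt-HodgeConjecture-24832`, h413 = `stmt-HodgeConjecture-24833`) until rung 0 closes.
## References
* [Serre1979] J.-P. Serre, *Local Fields*, GTM 67 (1979): Ch. III §6 Prop. 12 (orders of conductor `c`).
* [Kottwitz1986BaseChangeUnits] R. E. Kottwitz, *Base change for unit elements of Hecke algebras*, Compositio Math. 60 (1986): §1 pp. 240–241, §3 (congruence levels on lattices).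
* [Jacobowitz1962] R. Jacobowitz, *Hermitian forms over local fields*, Amer. J. Math. 84 (1962): §4 (duals, gluing).
* [Rogawski1990] J. D. Rogawski, *Automorphic Representations of Unitary Groups in Three Variables*, Ann. of Math. Stud. 123 (1990): §4.9 Prop. 4.9.1 (b) p. 55.
-/

set_option autoImplicit false

noncomputable section
namespace Summit.HodgeConjecture.HodgeConjecture.Cruxes.H413.F0P3cDyRamLowerLineOnShell

open scoped Valued WithZero Matrix MatrixGroups
open WithZero
open Literature.NumberTheory.Automorphic Literature.NumberTheory.Automorphic.HermitianLattice Literature.NumberTheory.Automorphic.UnitaryLatticeTree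
open Literature.NumberTheory.Rogawski1990
open Summit.HodgeConjecture.HodgeConjecture.Cruxes.H413.F0P3cDyRamToricCensusDefs
open Summit.HodgeConjecture.HodgeConjecture.Cruxes.H413.F0P3cDyRamFourFrameCensusDefs (LatticeInLevel LatticeNearTransvShell)
open Summit.HodgeConjecture.HodgeConjecture.Cruxes.H413.F0P3cDyRamShellLineModel (latticeInLevel_endoGL_sub_one_iff_isOrd latticeInLevel_endoGL_sub_one_sq_iff_isOrd)
open Summit.HodgeConjecture.HodgeConjecture.Cruxes.H413.F0P3cDyRamBoundaryCellLetterCardTwo (v_map_lt_one_iff_of_le_iff)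
open Summit.HodgeConjecture.HodgeConjecture.Cruxes.H413.F0P3cDyRamRayDominatedCellLetter (v_map_le_map_pow_of_le)
open Summit.HodgeConjecture.HodgeConjecture.Cruxes.H413.F0P3cDyRamTerminalCellOffShellCardTwo (mul_map_sub_mul_map_eq)
open Summit.HodgeConjecture.HodgeConjecture.Cruxes.H413.F0P3cDyRamDeepConeCellOffShellLevel (latticeInLevel_endoGL_sub_one_of_deep_level)

variable {E M : Type} [Field E] [Valued E ℤᵐ⁰] [Field M] [Valued M ℤᵐ⁰] {ρ : M →+* M} {α : M}
/-! ## §1 A POSITIVE square token: level `ℓ₀` and sizes give square level `m̃ = ℓ₀ + k` -/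

/-- **AN ORDER ELEMENT TIMES A SMALL ELEMENT STAYS IN THE ORDER.**  `ρ` isometric; `x ∈ 𝒪_cc`, `|y| ≤ 1`, `|x|·|y − ρy| ≤ |cc(α − ρα)|`.  THEN `x·y ∈ 𝒪_cc`
(`xy − ρ(xy) = (x − ρx)·y + ρx·(y − ρy)`; `y` itself need NOT lie in `𝒪_cc`). [cite: Serre1979, Ch. III §6 Prop. 12] -/
theorem isOrd_mul_of_v_mul_sub_map_le (hvρ : ∀ x, Valued.v (ρ x) = Valued.v x) {cc x y : M} (hx : IsOrd ρ α cc x) (hy : Valued.v y ≤ 1)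
    (hxy : Valued.v x * Valued.v (y - ρ y) ≤ Valued.v (cc * (α - ρ α))) : IsOrd ρ α cc (x * y) := by
  refine ⟨by rw [Valuation.map_mul]; exact mul_le_one' hx.1 hy, ?_⟩
  have e : x * y - ρ (x * y) = (x - ρ x) * y + ρ x * (y - ρ y) := by rw [map_mul]; ring
  rw [e]
  refine (Valuation.map_add _ _ _).trans (max_le ?_ ?_)
  · rw [Valuation.map_mul]
    calc Valued.v (x - ρ x) * Valued.v y ≤ Valued.v (cc * (α - ρ α)) * 1 := mul_le_mul' hx.2 hy
      _ = Valued.v (cc * (α - ρ α)) := mul_one _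
  · rw [Valuation.map_mul, hvρ]; exact hxy

/-- **CLAUSE 2 OF THE SQUARE TOKEN.**  `ρ` isometric, `ρ(ϖE) = ϖE`, `ϖE ≠ 0`; `w∕ϖE^{ℓ₀} ∈ 𝒪_cc` and `|w| ≤ |ϖE|^k`.  THEN `w²∕ϖE^{ℓ₀+k} ∈ 𝒪_cc`
(`w²∕ϖE^{ℓ₀+k} = (w∕ϖE^{ℓ₀})·(w∕ϖE^k)` and `|w∕ϖE^{ℓ₀}|·|(w − ρw)∕ϖE^k| = |w∕ϖE^k|·|(w − ρw)∕ϖE^{ℓ₀}| ≤ 1·|cc(α − ρα)|`). [cite: Serre1979, Ch. III §6 Prop. 12] -/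
theorem isOrd_sq_div_pow_of_isOrd_div_pow (hvρ : ∀ x, Valued.v (ρ x) = Valued.v x) {pE : M} (hρp : ρ pE = pE) (hp0 : pE ≠ 0)
    {cc w : M} (ℓ₀ k : ℕ) (hw : IsOrd ρ α cc (w / pE ^ ℓ₀)) (hwk : Valued.v w ≤ Valued.v pE ^ k) :
    IsOrd ρ α cc (w ^ 2 / pE ^ (ℓ₀ + k)) := by
  have hpl0 : pE ^ ℓ₀ ≠ 0 := pow_ne_zero _ hp0
  have hpk0 : pE ^ k ≠ 0 := pow_ne_zero _ hp0
  have hvpkpos : 0 < Valued.v (pE ^ k) := zero_lt_iff.2 ((Valuation.ne_zero_iff _).2 hpk0)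
  have hvplpos : 0 < Valued.v (pE ^ ℓ₀) := zero_lt_iff.2 ((Valuation.ne_zero_iff _).2 hpl0)
  have e : w ^ 2 / pE ^ (ℓ₀ + k) = (w / pE ^ ℓ₀) * (w / pE ^ k) := by rw [pow_add, div_mul_div_comm, sq]
  rw [e]
  refine isOrd_mul_of_v_mul_sub_map_le hvρ hw ?_ ?_
  · rw [Valuation.map_div, div_le_one₀ hvpkpos, Valuation.map_pow]; exact hwk
  · have e2 : w / pE ^ k - ρ (w / pE ^ k) = (w - ρ w) / pE ^ k := by rw [map_div₀, map_pow, hρp]; field_simp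
    have h2 := hw.2
    have e1 : w / pE ^ ℓ₀ - ρ (w / pE ^ ℓ₀) = (w - ρ w) / pE ^ ℓ₀ := by rw [map_div₀, map_pow, hρp]; field_simp
    rw [e1, Valuation.map_div, div_le_iff₀ hvplpos] at h2
    rw [e2, Valuation.map_div, Valuation.map_div, div_mul_div_comm, mul_comm (Valued.v (pE ^ ℓ₀)), div_le_iff₀ (mul_pos hvpkpos hvplpos)]
    calc Valued.v w * Valued.v (w - ρ w) ≤ Valued.v (pE ^ k) * (Valued.v (cc * (α - ρ α)) * Valued.v (pE ^ ℓ₀)) :=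
          mul_le_mul' (by rw [Valuation.map_pow]; exact hwk) h2
      _ = Valued.v (cc * (α - ρ α)) * (Valued.v (pE ^ k) * Valued.v (pE ^ ℓ₀)) := by ac_rfl

/-- **CLAUSE 3 OF THE SQUARE TOKEN.**  `ρ` isometric, `ρ(ϖE) = ϖE`, `ϖE ≠ 0`, `Y ≠ 0`; `t ∈ Fix ρ`; `μ∕(ϖE^{ℓ₀}·Y) ∈ 𝒪_cc` (the level-`ℓ₀` depth token), `|μ| ≤ |ϖE|^k`, `|t| ≤ |ϖE|^k`,
and the PRODUCT LETTER `|μ|·|μ − ρμ| ≤ |cc(α − ρα)|·|Y|·|ϖE|^{ℓ₀+k}`.  THEN `μ·(μ + 2t)∕(ϖE^{ℓ₀+k}·Y) ∈ 𝒪_cc`. [cite: Serre1979, Ch. III §6 Prop. 12] -/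
theorem isOrd_mul_div_pow_mul_of_isOrd_div_pow_mul (hvρ : ∀ x, Valued.v (ρ x) = Valued.v x) {pE : M} (hρp : ρ pE = pE) (hp0 : pE ≠ 0)
    {cc Y μ t : M} (hY0 : Y ≠ 0) (hρt : ρ t = t) (ℓ₀ k : ℕ) (hx : IsOrd ρ α cc (μ / (pE ^ ℓ₀ * Y)))
    (hμk : Valued.v μ ≤ Valued.v pE ^ k) (htk : Valued.v t ≤ Valued.v pE ^ k)
    (hprod : Valued.v μ * Valued.v (μ - ρ μ) ≤ Valued.v (cc * (α - ρ α)) * Valued.v Y * Valued.v pE ^ (ℓ₀ + k)) :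
    IsOrd ρ α cc (μ * (μ + 2 * t) / (pE ^ (ℓ₀ + k) * Y)) := by
  have hpl0 : pE ^ ℓ₀ ≠ 0 := pow_ne_zero _ hp0
  have hpk0 : pE ^ k ≠ 0 := pow_ne_zero _ hp0
  have hvpkpos : 0 < Valued.v (pE ^ k) := zero_lt_iff.2 ((Valuation.ne_zero_iff _).2 hpk0)
  have hvplpos : 0 < Valued.v (pE ^ ℓ₀) := zero_lt_iff.2 ((Valuation.ne_zero_iff _).2 hpl0)
  have hvYpos : 0 < Valued.v Y := zero_lt_iff.2 ((Valuation.ne_zero_iff _).2 hY0)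
  have e : μ * (μ + 2 * t) / (pE ^ (ℓ₀ + k) * Y) = (μ / (pE ^ ℓ₀ * Y)) * ((μ + 2 * t) / pE ^ k) := by rw [pow_add]; field_simp
  rw [e]
  refine isOrd_mul_of_v_mul_sub_map_le hvρ hx ?_ ?_
  · rw [Valuation.map_div, div_le_one₀ hvpkpos, Valuation.map_pow]
    refine (Valuation.map_add _ _ _).trans (max_le hμk ?_)
    have h2 : Valued.v (2 : M) ≤ 1 := by
      rw [show (2 : M) = 1 + 1 by norm_num]
      exact (Valuation.map_add _ _ _).trans (by rw [Valuation.map_one, max_self])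
    rw [Valuation.map_mul]
    calc Valued.v (2 : M) * Valued.v t ≤ 1 * Valued.v pE ^ k := mul_le_mul' h2 htk
      _ = Valued.v pE ^ k := one_mul _
  · have e2 : (μ + 2 * t) / pE ^ k - ρ ((μ + 2 * t) / pE ^ k) = (μ - ρ μ) / pE ^ k := by
      rw [map_div₀, map_pow, hρp, map_add, map_mul, map_ofNat, hρt]; field_simp; ring
    rw [e2, Valuation.map_div, Valuation.map_div, Valuation.map_mul, div_mul_div_comm, div_le_iff₀ (mul_pos (mul_pos hvplpos hvYpos) hvpkpos)]
    calc Valued.v μ * Valued.v (μ - ρ μ) ≤ Valued.v (cc * (α - ρ α)) * Valued.v Y * Valued.v pE ^ (ℓ₀ + k) := hprod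
      _ = Valued.v (cc * (α - ρ α)) * (Valued.v (pE ^ ℓ₀) * Valued.v Y * Valued.v (pE ^ k)) := by rw [pow_add, Valuation.map_pow, Valuation.map_pow]; ac_rfl

/-- **HEAD — «A POSITIVE SQUARE TOKEN FROM THE LEVEL TOKEN AND SIZES» (any cell, any `q`, any `d`).**  Frame: ★ `…ShellLineModel.latticeInLevel_endoGL_sub_one_sq_iff_isOrd`'s
glued-vertex letters VERBATIM + `Fix ρ ⊇ jE(E)`, `|jE c| ≤ 1 ↔ |c| ≤ 1`; CELL `hYb : |Y| = |ϖE|^b`.  LETTERS: `hlev : LatticeInLevel ϖ ℓ₀ (Γ − 1) L₃`, `hmk : ℓ₀ + k = m̃`,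
`huk : |u₀₀ − 1| ≤ |ϖ^k|`, `hμk : |lam − jE u₀₀| ≤ |ϖE|^k`, and the PRODUCT LETTER `hprod : |μ|·|μ − ρμ| ≤ |cc(α − ρα)|·|Y|·|ϖE|^{m̃}` (`μ = lam − jE u₀₀`).  THEN
`LatticeInLevel ϖ m̃ ((Γ − 1)·(Γ − 1)) L₃`, `Γ = endoGL (γ₂, u)`. [cite: Kottwitz1986BaseChangeUnits, §3] [cite: Serre1979, Ch. III §6 Prop. 12] [cite: Jacobowitz1962, §4] -/
theorem latticeInLevel_sq_endoGL_sub_one_of_level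
    (hvρ : ∀ x, Valued.v (ρ x) = Valued.v x) {ϖ : E} (hϖ : Valued.v ϖ = exp (-1 : ℤ))
    (jE : E →+* M) (hjv : ∀ c, Valued.v (jE c) ≤ 1 ↔ Valued.v c ≤ 1) (hjfix : ∀ z, ρ z = z ↔ ∃ c, jE c = z)
    (φ : (Fin 2 → E) →+ M) (hφs : ∀ (c : E) (x : Fin 2 → E), φ (c • x) = jE c * φ x) (hφi : Function.Injective φ)
    {γ₂ : GL (Fin 2) E} {lam : M} (hφγ : ∀ x, φ ((γ₂ : Matrix (Fin 2) (Fin 2) E) *ᵥ x) = lam * φ x)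
    {L₃ : Submodule 𝒪[E] (Fin 3 → E)} {b : ℕ} (hb : ∀ a : E, (Pi.single 1 a : Fin 3 → E) ∈ L₃ ↔ Valued.v a ≤ Valued.v ϖ ^ b)
    (hpr : ∀ x ∈ L₃, Valued.v (x 1) * Valued.v ϖ ^ b ≤ 1)
    {B₂ : Submodule 𝒪[E] (Fin 2 → E)} {w₀ : Fin 2 → E} {g₀ : Fin 3 → E}
    (hB : B₂.map ((Matrix.toLin' (!![1, 0; 0, 0; 0, 1] : Matrix (Fin 3) (Fin 2) E)).restrictScalars 𝒪[E]) =
      L₃ ⊓ LinearMap.ker ((LinearMap.proj (1 : Fin 3) : (Fin 3 → E) →ₗ[E] E).restrictScalars 𝒪[E]))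
    (hg₀ : g₀ ∈ L₃) (hg₀1 : Valued.v (g₀ 1) * Valued.v ϖ ^ b = 1) (hprg : g₀ - Pi.single 1 (g₀ 1) = ![w₀ 0, 0, w₀ 1])
    {Λ : AddSubgroup M} (hBΛ : B₂.toAddSubgroup.map φ = Λ) {cc x₀ Y : M} (hx₀ : x₀ ≠ 0)
    (hΛx : ∀ x, x ∈ Λ ↔ ∃ z, IsOrd ρ α cc z ∧ x = x₀ * z) (hw₀Y : φ w₀ = Y⁻¹ * x₀) (hYb : Valued.v Y = Valued.v (jE ϖ) ^ b)
    (u : GL (Fin 1) E) (ℓ₀ k mt : ℕ) (hmk : ℓ₀ + k = mt)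
    (hlev : LatticeInLevel ϖ ℓ₀ ((((endoGL (γ₂, u) : GL (Fin 3) E) : Matrix (Fin 3) (Fin 3) E) - 1)) L₃)
    (huk : Valued.v ((u : Matrix (Fin 1) (Fin 1) E) 0 0 - 1) ≤ Valued.v (ϖ ^ k))
    (hμk : Valued.v (lam - jE ((u : Matrix (Fin 1) (Fin 1) E) 0 0)) ≤ Valued.v (jE ϖ) ^ k)
    (hprod : Valued.v (lam - jE ((u : Matrix (Fin 1) (Fin 1) E) 0 0)) * Valued.v ((lam - jE ((u : Matrix (Fin 1) (Fin 1) E) 0 0)) - ρ (lam - jE ((u : Matrix (Fin 1) (Fin 1) E) 0 0))) ≤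
      Valued.v (cc * (α - ρ α)) * Valued.v Y * Valued.v (jE ϖ) ^ mt) :
    LatticeInLevel ϖ mt ((((endoGL (γ₂, u) : GL (Fin 3) E) : Matrix (Fin 3) (Fin 3) E) - 1) * ((((endoGL (γ₂, u) : GL (Fin 3) E) : Matrix (Fin 3) (Fin 3) E) - 1))) L₃ := by
  have hvϖ0 : Valued.v ϖ ≠ 0 := by rw [hϖ]; exact exp_ne_zero
  have hϖ0 : ϖ ≠ 0 := fun h0 => hvϖ0 (by rw [h0, map_zero])
  have hϖlt : Valued.v ϖ < 1 := by rw [hϖ, ← exp_zero, exp_lt_exp]; norm_num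
  have hjϖ0 : jE ϖ ≠ 0 := (map_ne_zero jE).2 hϖ0
  have hvjϖ0 : Valued.v (jE ϖ) ≠ 0 := (Valuation.ne_zero_iff _).2 hjϖ0
  have hjϖle : Valued.v (jE ϖ) ≤ 1 := ((v_map_lt_one_iff_of_le_iff jE hjv ϖ).2 hϖlt).le
  have hρϖ : ρ (jE ϖ) = jE ϖ := (hjfix _).2 ⟨ϖ, rfl⟩
  have hY0 : Y ≠ 0 := fun h0 => by
    rw [h0, Valuation.map_zero] at hYb
    exact pow_ne_zero b hvjϖ0 hYb.symm
  -- the three level-`ℓ₀` clauses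
  obtain ⟨h1, h2, h3⟩ := (latticeInLevel_endoGL_sub_one_iff_isOrd hvρ hϖ jE φ hφs hφi hφγ hb hpr hB hg₀ hg₀1 hprg hBΛ hx₀ hY0 hΛx hw₀Y u ℓ₀).1 hlev
  -- `t = jE u₀₀ − 1 ∈ Fix ρ`, `|t| ≤ |ϖE|^k`; `|lam − 1| ≤ |ϖE|^k`
  have hρt : ρ (jE ((u : Matrix (Fin 1) (Fin 1) E) 0 0) - 1) = jE ((u : Matrix (Fin 1) (Fin 1) E) 0 0) - 1 := by
    rw [map_sub, map_one, (hjfix _).2 ⟨_, rfl⟩]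
  have huk' : Valued.v ((u : Matrix (Fin 1) (Fin 1) E) 0 0 - 1) ≤ Valued.v ϖ ^ k := by rw [← Valuation.map_pow]; exact huk
  have htk : Valued.v (jE ((u : Matrix (Fin 1) (Fin 1) E) 0 0) - 1) ≤ Valued.v (jE ϖ) ^ k := by
    have h := v_map_le_map_pow_of_le jE hjv hϖ0 huk'
    rwa [map_sub, map_one] at h
  have hwk : Valued.v (lam - 1) ≤ Valued.v (jE ϖ) ^ k := by
    have e : lam - 1 = (lam - jE ((u : Matrix (Fin 1) (Fin 1) E) 0 0)) + (jE ((u : Matrix (Fin 1) (Fin 1) E) 0 0) - 1) := by ring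
    rw [e]
    exact (Valuation.map_add _ _ _).trans (max_le hμk htk)
  rw [latticeInLevel_endoGL_sub_one_sq_iff_isOrd hvρ hϖ jE φ hφs hφi hφγ hb hpr hB hg₀ hg₀1 hprg hBΛ hx₀ hY0 hΛx hw₀Y u mt, ← hmk]
  refine ⟨?_, ?_, ?_⟩
  · -- `|(u₀₀ − 1)²| ≤ |ϖ^{ℓ₀}|·|ϖ^k|`
    rw [Valuation.map_pow, pow_add, Valuation.map_mul, sq]
    exact mul_le_mul' h1 huk
  · exact isOrd_sq_div_pow_of_isOrd_div_pow hvρ hρϖ hjϖ0 ℓ₀ k h2 hwk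
  · have e : (lam - 1) ^ 2 - (jE ((u : Matrix (Fin 1) (Fin 1) E) 0 0) - 1) ^ 2 =
        (lam - jE ((u : Matrix (Fin 1) (Fin 1) E) 0 0)) * ((lam - jE ((u : Matrix (Fin 1) (Fin 1) E) 0 0)) + 2 * (jE ((u : Matrix (Fin 1) (Fin 1) E) 0 0) - 1)) := by ring
    rw [e]
    refine isOrd_mul_div_pow_mul_of_isOrd_div_pow_mul hvρ hρϖ hjϖ0 hY0 hρt ℓ₀ k h3 hμk htk ?_
    rw [hmk]; exact hprod
/-! ## §2 The lower line `j + b + ℓ₀ = jl′` (`2b + ℓ₀ < m₀`, `b < j`) sits on level EXACTLY `ℓ₀` and on every square level -/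

/-- **THE LOWER-LINE DIGIT IS EXACT (general `ℓ₀`).**  `ρ` isometric, `ρα ≠ α`, `|α| ≤ 1`, `ρ(ϖE) = ϖE`, `|ϖ| = exp(−1)`, `|jE c| ≤ 1 ↔ |c| ≤ 1`; CELL `cc ≠ 0`, `Y ∈ 𝒪_cc`,
`|Y| = |ϖE|^b`, `|cc| < |ϖE|^b` (`b < j`); LINE letters `|μ| ≤ |ϖE|^{2b+ℓ₀+1}` (below the row) and `|μ − ρμ| = |cc(α − ρα)|·|ϖE|^{b+ℓ₀}` EXACTLY (`j + b + ℓ₀ = jl′`).  THEN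
`¬ IsOrd ρ α cc (μ ∕ (ϖE^{ℓ₀+1}·Y))`: the `B·P` term has size EXACTLY `|cc|·|ϖE|^{2b+ℓ₀}` and dominates `A·Q`, so the level-`(ℓ₀ + 1)` token fails (★ p863123 §3 is `ℓ₀ = 0`).
[cite: Serre1979, Ch. III §6 Prop. 12] [cite: Kottwitz1986BaseChangeUnits, §1 pp. 240–241] -/
theorem not_isOrd_div_pow_succ_mul_of_line
    (hvρ : ∀ x, Valued.v (ρ x) = Valued.v x) (hα : ρ α ≠ α) (hα1 : Valued.v α ≤ 1)
    (jE : E →+* M) (hjv : ∀ c, Valued.v (jE c) ≤ 1 ↔ Valued.v c ≤ 1) {ϖ : E} (hϖ : Valued.v ϖ = exp (-1 : ℤ)) (hρϖ : ρ (jE ϖ) = jE ϖ)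
    {cc : M} (hc0 : cc ≠ 0) {Y : M} (hYO : IsOrd ρ α cc Y) {b : ℕ} (hYb : Valued.v Y = Valued.v (jE ϖ) ^ b) (hcb : Valued.v cc < Valued.v (jE ϖ) ^ b)
    (ℓ₀ : ℕ) {μ : M} (hμ : Valued.v μ ≤ Valued.v (jE ϖ) ^ (2 * b + ℓ₀ + 1))
    (hanti : Valued.v (μ - ρ μ) = Valued.v (cc * (α - ρ α)) * Valued.v (jE ϖ) ^ (b + ℓ₀)) :
    ¬ IsOrd ρ α cc (μ / (jE ϖ ^ (ℓ₀ + 1) * Y)) := by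
  intro hO
  have hα0 : α - ρ α ≠ 0 := sub_ne_zero.2 (Ne.symm hα)
  have hvα0 : Valued.v (α - ρ α) ≠ 0 := (Valuation.ne_zero_iff _).2 hα0
  have hvαpos : 0 < Valued.v (α - ρ α) := zero_lt_iff.2 hvα0
  have hvϖ0 : Valued.v ϖ ≠ 0 := by rw [hϖ]; exact exp_ne_zero
  have hϖ0 : ϖ ≠ 0 := fun h0 => hvϖ0 (by rw [h0, map_zero])
  have hϖlt : Valued.v ϖ < 1 := by rw [hϖ, ← exp_zero, exp_lt_exp]; norm_num
  have hjϖ0 : jE ϖ ≠ 0 := (map_ne_zero jE).2 hϖ0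
  have hvjϖ0 : Valued.v (jE ϖ) ≠ 0 := (Valuation.ne_zero_iff _).2 hjϖ0
  have hvjϖpos : 0 < Valued.v (jE ϖ) := zero_lt_iff.2 hvjϖ0
  have hjϖlt : Valued.v (jE ϖ) < 1 := (v_map_lt_one_iff_of_le_iff jE hjv ϖ).2 hϖlt
  have hpbpos : 0 < Valued.v (jE ϖ) ^ b := pow_pos hvjϖpos _
  have hpLpos : 0 < Valued.v (jE ϖ ^ (ℓ₀ + 1)) := by rw [Valuation.map_pow]; exact pow_pos hvjϖpos _
  have hvc0 : Valued.v cc ≠ 0 := (Valuation.ne_zero_iff _).2 hc0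
  have hvcpos : 0 < Valued.v cc := zero_lt_iff.2 hvc0
  have hY0 : Y ≠ 0 := fun h0 => by
    rw [h0, Valuation.map_zero] at hYb
    exact pow_ne_zero b hvjϖ0 hYb.symm
  have hρY0 : ρ Y ≠ 0 := (map_ne_zero ρ).2 hY0
  -- the level-`(ℓ₀ + 1)` estimate carried by `hO`
  have hO2 : Valued.v (μ / Y - ρ (μ / Y)) ≤ Valued.v (cc * (α - ρ α)) * Valued.v (jE ϖ ^ (ℓ₀ + 1)) := by
    have e : μ / (jE ϖ ^ (ℓ₀ + 1) * Y) - ρ (μ / (jE ϖ ^ (ℓ₀ + 1) * Y)) = (μ / Y - ρ (μ / Y)) / jE ϖ ^ (ℓ₀ + 1) := by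
      rw [map_div₀, map_div₀, map_mul, map_pow, hρϖ]
      field_simp
    have h := hO.2
    rwa [e, Valuation.map_div, div_le_iff₀ hpLpos] at h
  -- coordinates
  set B : M := (μ - ρ μ) / (α - ρ α) with hBdef
  set Q : M := (Y - ρ Y) / (α - ρ α) with hQdef
  set A : M := μ - B * α with hAdef
  set P : M := Y - Q * α with hPdef
  clear_value A P
  clear_value B Q
  have hvB : Valued.v B = Valued.v cc * Valued.v (jE ϖ) ^ (b + ℓ₀) := by
    have h : Valued.v B * Valued.v (α - ρ α) = Valued.v cc * Valued.v (jE ϖ) ^ (b + ℓ₀) * Valued.v (α - ρ α) := by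
      rw [hBdef, Valuation.map_div, div_mul_cancel₀ _ hvα0, hanti, Valuation.map_mul]; ac_rfl
    exact mul_right_cancel₀ hvα0 h
  have hvQ : Valued.v Q ≤ Valued.v cc := by
    rw [hQdef, Valuation.map_div, div_le_iff₀ hvαpos, ← Valuation.map_mul]
    exact hYO.2
  have hvP : Valued.v P = Valued.v (jE ϖ) ^ b := by
    have hlt : Valued.v (Q * α) < Valued.v Y := by
      rw [Valuation.map_mul, hYb]
      calc Valued.v Q * Valued.v α ≤ Valued.v cc * 1 := mul_le_mul' hvQ hα1
        _ = Valued.v cc := mul_one _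
        _ < Valued.v (jE ϖ) ^ b := hcb
    rw [hPdef, sub_eq_add_neg, Valuation.map_add_eq_of_lt_left _ (by rw [Valuation.map_neg]; exact hlt), hYb]
  have hBP : Valued.v (B * P) = Valued.v cc * Valued.v (jE ϖ) ^ (2 * b + ℓ₀) := by
    rw [Valuation.map_mul, hvB, hvP, mul_assoc, ← pow_add]; congr 2; omega
  have hvA : Valued.v A < Valued.v (jE ϖ) ^ (2 * b + ℓ₀) := by
    rw [hAdef]
    refine lt_of_le_of_lt (Valuation.map_sub _ _ _) (max_lt ?_ ?_)
    · exact lt_of_le_of_lt hμ (pow_lt_pow_right_of_lt_one₀ hvjϖpos hjϖlt (by omega))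
    · rw [Valuation.map_mul, hvB]
      calc Valued.v cc * Valued.v (jE ϖ) ^ (b + ℓ₀) * Valued.v α ≤ Valued.v cc * Valued.v (jE ϖ) ^ (b + ℓ₀) * 1 := mul_le_mul_right hα1 _
        _ = Valued.v cc * Valued.v (jE ϖ) ^ (b + ℓ₀) := mul_one _
        _ < Valued.v (jE ϖ) ^ b * Valued.v (jE ϖ) ^ (b + ℓ₀) := mul_lt_mul_of_pos_right hcb (pow_pos hvjϖpos _)
        _ = Valued.v (jE ϖ) ^ (2 * b + ℓ₀) := by rw [← pow_add]; congr 1; omega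
  have hdom : Valued.v (A * Q) < Valued.v (B * P) := by
    rw [hBP, Valuation.map_mul]
    calc Valued.v A * Valued.v Q ≤ Valued.v A * Valued.v cc := mul_le_mul_right hvQ _
      _ < Valued.v (jE ϖ) ^ (2 * b + ℓ₀) * Valued.v cc := mul_lt_mul_of_pos_right hvA hvcpos
      _ = Valued.v cc * Valued.v (jE ϖ) ^ (2 * b + ℓ₀) := mul_comm _ _
  have hdiff : Valued.v (B * P - A * Q) = Valued.v cc * Valued.v (jE ϖ) ^ (2 * b + ℓ₀) := by
    rw [sub_eq_add_neg, Valuation.map_add_eq_of_lt_left _ (by rw [Valuation.map_neg]; exact hdom), hBP]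
  -- the identity and the contradiction `|ϖE|^{2b+ℓ₀} ≤ |ϖE|^{2b+ℓ₀+1}`
  have hident : μ / Y - ρ (μ / Y) = (B * P - A * Q) * (α - ρ α) / (Y * ρ Y) := by
    rw [map_div₀, div_sub_div _ _ hY0 hρY0, mul_map_sub_mul_map_eq hα hBdef hAdef hQdef hPdef]
  rw [hident, Valuation.map_div, Valuation.map_mul, Valuation.map_mul, hvρ, hYb, div_le_iff₀ (mul_pos hpbpos hpbpos), hdiff, Valuation.map_mul,
    Valuation.map_pow] at hO2
  have hlt : Valued.v cc * Valued.v (α - ρ α) * Valued.v (jE ϖ) ^ (ℓ₀ + 1) * (Valued.v (jE ϖ) ^ b * Valued.v (jE ϖ) ^ b) <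
      Valued.v cc * Valued.v (jE ϖ) ^ (2 * b + ℓ₀) * Valued.v (α - ρ α) :=
    calc Valued.v cc * Valued.v (α - ρ α) * Valued.v (jE ϖ) ^ (ℓ₀ + 1) * (Valued.v (jE ϖ) ^ b * Valued.v (jE ϖ) ^ b)
        = Valued.v (jE ϖ) ^ (2 * b + ℓ₀ + 1) * (Valued.v cc * Valued.v (α - ρ α)) := by
          rw [show 2 * b + ℓ₀ + 1 = (ℓ₀ + 1) + b + b by omega, pow_add (Valued.v (jE ϖ)) (ℓ₀ + 1 + b) b,
            pow_add (Valued.v (jE ϖ)) (ℓ₀ + 1) b]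
          ac_rfl
      _ < Valued.v (jE ϖ) ^ (2 * b + ℓ₀) * (Valued.v cc * Valued.v (α - ρ α)) :=
          mul_lt_mul_of_pos_right (pow_lt_pow_right_of_lt_one₀ hvjϖpos hjϖlt (by omega)) (mul_pos hvcpos hvαpos)
      _ = Valued.v cc * Valued.v (jE ϖ) ^ (2 * b + ℓ₀) * Valued.v (α - ρ α) := by ac_rfl
  exact absurd (lt_of_lt_of_le hlt hO2) (lt_irrefl _)

/-- **HEAD — «THE LOWER LINE IS NOT ON LEVEL `ℓ₀ + 1`»** (any `q`): ★ `…ShellLineModel`'s glued-vertex letters + `Fix ρ ⊇ jE(E)`; CELL `cc ≠ 0`, `hYO hYb`, `|cc| < |ϖE|^b`;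
LINE letters `hμ : |lam − jE u₀₀| ≤ |ϖE|^{2b+ℓ₀+1}`, `hanti : |μ − ρμ| = |cc(α − ρα)|·|ϖE|^{b+ℓ₀}`.  THEN `¬ LatticeInLevel ϖ (ℓ₀ + 1) (Γ − 1) L₃`.
[cite: Kottwitz1986BaseChangeUnits, §3] [cite: Serre1979, Ch. III §6 Prop. 12] [cite: Jacobowitz1962, §4] -/
theorem not_latticeInLevel_succ_endoGL_sub_one_of_line
    (hvρ : ∀ x, Valued.v (ρ x) = Valued.v x) (hα : ρ α ≠ α) (hα1 : Valued.v α ≤ 1)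
    {ϖ : E} (hϖ : Valued.v ϖ = exp (-1 : ℤ))
    (jE : E →+* M) (hjv : ∀ c, Valued.v (jE c) ≤ 1 ↔ Valued.v c ≤ 1) (hjfix : ∀ z, ρ z = z ↔ ∃ c, jE c = z)
    (φ : (Fin 2 → E) →+ M) (hφs : ∀ (c : E) (x : Fin 2 → E), φ (c • x) = jE c * φ x) (hφi : Function.Injective φ)
    {γ₂ : GL (Fin 2) E} {lam : M} (hφγ : ∀ x, φ ((γ₂ : Matrix (Fin 2) (Fin 2) E) *ᵥ x) = lam * φ x)
    {L₃ : Submodule 𝒪[E] (Fin 3 → E)} {b : ℕ} (hb : ∀ a : E, (Pi.single 1 a : Fin 3 → E) ∈ L₃ ↔ Valued.v a ≤ Valued.v ϖ ^ b)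
    (hpr : ∀ x ∈ L₃, Valued.v (x 1) * Valued.v ϖ ^ b ≤ 1)
    {B₂ : Submodule 𝒪[E] (Fin 2 → E)} {w₀ : Fin 2 → E} {g₀ : Fin 3 → E}
    (hB : B₂.map ((Matrix.toLin' (!![1, 0; 0, 0; 0, 1] : Matrix (Fin 3) (Fin 2) E)).restrictScalars 𝒪[E]) =
      L₃ ⊓ LinearMap.ker ((LinearMap.proj (1 : Fin 3) : (Fin 3 → E) →ₗ[E] E).restrictScalars 𝒪[E]))
    (hg₀ : g₀ ∈ L₃) (hg₀1 : Valued.v (g₀ 1) * Valued.v ϖ ^ b = 1) (hprg : g₀ - Pi.single 1 (g₀ 1) = ![w₀ 0, 0, w₀ 1])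
    {Λ : AddSubgroup M} (hBΛ : B₂.toAddSubgroup.map φ = Λ) {cc x₀ Y : M} (hc0 : cc ≠ 0) (hx₀ : x₀ ≠ 0)
    (hΛx : ∀ x, x ∈ Λ ↔ ∃ z, IsOrd ρ α cc z ∧ x = x₀ * z) (hw₀Y : φ w₀ = Y⁻¹ * x₀)
    (hYO : IsOrd ρ α cc Y) (hYb : Valued.v Y = Valued.v (jE ϖ) ^ b) (hcb : Valued.v cc < Valued.v (jE ϖ) ^ b) (u : GL (Fin 1) E) (ℓ₀ : ℕ)
    (hμ : Valued.v (lam - jE ((u : Matrix (Fin 1) (Fin 1) E) 0 0)) ≤ Valued.v (jE ϖ) ^ (2 * b + ℓ₀ + 1))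
    (hanti : Valued.v ((lam - jE ((u : Matrix (Fin 1) (Fin 1) E) 0 0)) - ρ (lam - jE ((u : Matrix (Fin 1) (Fin 1) E) 0 0))) =
      Valued.v (cc * (α - ρ α)) * Valued.v (jE ϖ) ^ (b + ℓ₀)) :
    ¬ LatticeInLevel ϖ (ℓ₀ + 1) ((((endoGL (γ₂, u) : GL (Fin 3) E) : Matrix (Fin 3) (Fin 3) E) - 1)) L₃ := by
  have hvϖ0 : Valued.v ϖ ≠ 0 := by rw [hϖ]; exact exp_ne_zero
  have hjϖ0 : jE ϖ ≠ 0 := (map_ne_zero jE).2 (fun h0 => hvϖ0 (by rw [h0, map_zero]))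
  have hρϖ : ρ (jE ϖ) = jE ϖ := (hjfix _).2 ⟨ϖ, rfl⟩
  have hY0 : Y ≠ 0 := fun h0 => by
    rw [h0, Valuation.map_zero] at hYb
    exact pow_ne_zero b ((Valuation.ne_zero_iff _).2 hjϖ0) hYb.symm
  rw [latticeInLevel_endoGL_sub_one_iff_isOrd hvρ hϖ jE φ hφs hφi hφγ hb hpr hB hg₀ hg₀1 hprg hBΛ hx₀ hY0 hΛx hw₀Y u (ℓ₀ + 1)]
  rintro ⟨-, -, h3⟩
  exact not_isOrd_div_pow_succ_mul_of_line hvρ hα hα1 jE hjv hϖ hρϖ hc0 hYO hYb hcb ℓ₀ hμ hanti h3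

/-- **HEAD — «THE LOWER LINE IS ON BOTH SHELLS» (any `q`, any parity, any square level).**  Frame: ★ `…ShellLineModel`'s glued-vertex letters VERBATIM + `Fix ρ ⊇ jE(E)`; CELL
`cc ≠ 0`, `hYO hYb`, `|cc| < |ϖE|^b` (`b < j`); the literal's `hum : |u₀₀ − 1| ≤ |ϖ^{m′}|` with `ℓ₀ ≤ m′`, `k ≤ m′`; SQUARE LEVEL `m̃ = ℓ₀ + k` with `hμk : |μ| ≤ |ϖE|^k`;
LOWER-LINE letters `hμ : |μ| ≤ |ϖE|^{2b+ℓ₀+1}` (below the row `2b + ℓ₀ < m₀`) and `hanti : |μ − ρμ| = |cc(α − ρα)|·|ϖE|^{b+ℓ₀}` (the line `j + b + ℓ₀ = jl′`).  THEN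
`LatticeNearTransvShell ϖ ℓ₀ m̃ (Γ − 1) L₃`: level `ℓ₀` (★ p863123 at `L := ℓ₀`), not level `ℓ₀ + 1` (the digit), square level `m̃` (§1, product letter
`|μ|·|μ − ρμ| ≤ |ϖE|^k·|cc(α − ρα)|·|ϖE|^{b+ℓ₀} = |cc(α − ρα)|·|Y|·|ϖE|^{m̃}`).  At `m̃ ∈ {m*, m_c}` (`k = m̃ − d % 2 ≤ N₀`) both shell conjuncts of ED. 4's literals hold.
[cite: Kottwitz1986BaseChangeUnits, §3] [cite: Rogawski1990, §4.9 Prop. 4.9.1 (b) p. 55] [cite: Serre1979, Ch. III §6 Prop. 12] [cite: Jacobowitz1962, §4] -/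
theorem latticeNearTransvShell_of_line
    (hvρ : ∀ x, Valued.v (ρ x) = Valued.v x) (hα : ρ α ≠ α) (hα1 : Valued.v α ≤ 1)
    {ϖ : E} (hϖ : Valued.v ϖ = exp (-1 : ℤ))
    (jE : E →+* M) (hjv : ∀ c, Valued.v (jE c) ≤ 1 ↔ Valued.v c ≤ 1) (hjfix : ∀ z, ρ z = z ↔ ∃ c, jE c = z)
    (φ : (Fin 2 → E) →+ M) (hφs : ∀ (c : E) (x : Fin 2 → E), φ (c • x) = jE c * φ x) (hφi : Function.Injective φ)
    {γ₂ : GL (Fin 2) E} {lam : M} (hφγ : ∀ x, φ ((γ₂ : Matrix (Fin 2) (Fin 2) E) *ᵥ x) = lam * φ x)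
    {L₃ : Submodule 𝒪[E] (Fin 3 → E)} {b : ℕ} (hb : ∀ a : E, (Pi.single 1 a : Fin 3 → E) ∈ L₃ ↔ Valued.v a ≤ Valued.v ϖ ^ b)
    (hpr : ∀ x ∈ L₃, Valued.v (x 1) * Valued.v ϖ ^ b ≤ 1)
    {B₂ : Submodule 𝒪[E] (Fin 2 → E)} {w₀ : Fin 2 → E} {g₀ : Fin 3 → E}
    (hB : B₂.map ((Matrix.toLin' (!![1, 0; 0, 0; 0, 1] : Matrix (Fin 3) (Fin 2) E)).restrictScalars 𝒪[E]) =
      L₃ ⊓ LinearMap.ker ((LinearMap.proj (1 : Fin 3) : (Fin 3 → E) →ₗ[E] E).restrictScalars 𝒪[E]))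
    (hg₀ : g₀ ∈ L₃) (hg₀1 : Valued.v (g₀ 1) * Valued.v ϖ ^ b = 1) (hprg : g₀ - Pi.single 1 (g₀ 1) = ![w₀ 0, 0, w₀ 1])
    {Λ : AddSubgroup M} (hBΛ : B₂.toAddSubgroup.map φ = Λ) {cc x₀ Y : M} (hc0 : cc ≠ 0) (hx₀ : x₀ ≠ 0)
    (hΛx : ∀ x, x ∈ Λ ↔ ∃ z, IsOrd ρ α cc z ∧ x = x₀ * z) (hw₀Y : φ w₀ = Y⁻¹ * x₀)
    (hYO : IsOrd ρ α cc Y) (hYb : Valued.v Y = Valued.v (jE ϖ) ^ b) (hcb : Valued.v cc < Valued.v (jE ϖ) ^ b)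
    (u : GL (Fin 1) E) (ℓ₀ k mt : ℕ) (hmk : ℓ₀ + k = mt) {m' : ℕ} (hLm : ℓ₀ ≤ m') (hkm : k ≤ m')
    (hum : Valued.v ((u : Matrix (Fin 1) (Fin 1) E) 0 0 - 1) ≤ Valued.v (ϖ ^ m'))
    (hμk : Valued.v (lam - jE ((u : Matrix (Fin 1) (Fin 1) E) 0 0)) ≤ Valued.v (jE ϖ) ^ k)
    (hμ : Valued.v (lam - jE ((u : Matrix (Fin 1) (Fin 1) E) 0 0)) ≤ Valued.v (jE ϖ) ^ (2 * b + ℓ₀ + 1))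
    (hanti : Valued.v ((lam - jE ((u : Matrix (Fin 1) (Fin 1) E) 0 0)) - ρ (lam - jE ((u : Matrix (Fin 1) (Fin 1) E) 0 0))) =
      Valued.v (cc * (α - ρ α)) * Valued.v (jE ϖ) ^ (b + ℓ₀)) :
    LatticeNearTransvShell ϖ ℓ₀ mt ((((endoGL (γ₂, u) : GL (Fin 3) E) : Matrix (Fin 3) (Fin 3) E) - 1)) L₃ := by
  have hvϖ0 : Valued.v ϖ ≠ 0 := by rw [hϖ]; exact exp_ne_zero
  have hϖ0 : ϖ ≠ 0 := fun h0 => hvϖ0 (by rw [h0, map_zero])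
  have hϖlt : Valued.v ϖ < 1 := by rw [hϖ, ← exp_zero, exp_lt_exp]; norm_num
  have hjϖ0 : jE ϖ ≠ 0 := (map_ne_zero jE).2 hϖ0
  have hvjϖ0 : Valued.v (jE ϖ) ≠ 0 := (Valuation.ne_zero_iff _).2 hjϖ0
  have hvjϖpos : 0 < Valued.v (jE ϖ) := zero_lt_iff.2 hvjϖ0
  have hjϖle : Valued.v (jE ϖ) ≤ 1 := ((v_map_lt_one_iff_of_le_iff jE hjv ϖ).2 hϖlt).le
  -- level `ℓ₀`: the line is deep by `ℓ₀`
  have hμ' : Valued.v (lam - jE ((u : Matrix (Fin 1) (Fin 1) E) 0 0)) ≤ Valued.v (jE ϖ) ^ (2 * b + ℓ₀) :=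
    hμ.trans (pow_le_pow_right_of_le_one' hjϖle (by omega))
  have hlev : LatticeInLevel ϖ ℓ₀ ((((endoGL (γ₂, u) : GL (Fin 3) E) : Matrix (Fin 3) (Fin 3) E) - 1)) L₃ :=
    latticeInLevel_endoGL_sub_one_of_deep_level hvρ hα hα1 hϖ jE hjv hjfix φ hφs hφi hφγ hb hpr hB hg₀ hg₀1 hprg hBΛ hx₀ hΛx hw₀Y hYO hYb hcb.le u ℓ₀ hLm
      hum hμ' hanti.le
  refine ⟨hlev, not_latticeInLevel_succ_endoGL_sub_one_of_line hvρ hα hα1 hϖ jE hjv hjfix φ hφs hφi hφγ hb hpr hB hg₀ hg₀1 hprg hBΛ hc0 hx₀ hΛx hw₀Y hYO hYb hcb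
    u ℓ₀ hμ hanti, ?_⟩
  -- the square level `mt = ℓ₀ + k`
  have huk : Valued.v ((u : Matrix (Fin 1) (Fin 1) E) 0 0 - 1) ≤ Valued.v (ϖ ^ k) :=
    hum.trans (by rw [Valuation.map_pow, Valuation.map_pow]; exact pow_le_pow_right_of_le_one' hϖlt.le hkm)
  refine latticeInLevel_sq_endoGL_sub_one_of_level hvρ hϖ jE hjv hjfix φ hφs hφi hφγ hb hpr hB hg₀ hg₀1 hprg hBΛ hx₀ hΛx hw₀Y hYb u ℓ₀ k mt hmk hlev huk hμk ?_
  rw [hanti, hYb, ← hmk, pow_add (Valued.v (jE ϖ)) b ℓ₀, pow_add (Valued.v (jE ϖ)) ℓ₀ k]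
  calc Valued.v (lam - jE ((u : Matrix (Fin 1) (Fin 1) E) 0 0)) * (Valued.v (cc * (α - ρ α)) * (Valued.v (jE ϖ) ^ b * Valued.v (jE ϖ) ^ ℓ₀))
      ≤ Valued.v (jE ϖ) ^ k * (Valued.v (cc * (α - ρ α)) * (Valued.v (jE ϖ) ^ b * Valued.v (jE ϖ) ^ ℓ₀)) := mul_le_mul_left hμk _
    _ = Valued.v (cc * (α - ρ α)) * Valued.v (jE ϖ) ^ b * (Valued.v (jE ϖ) ^ ℓ₀ * Valued.v (jE ϖ) ^ k) := by
          simp only [mul_assoc, mul_comm]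

end Summit.HodgeConjecture.HodgeConjecture.Cruxes.H413.F0P3cDyRamLowerLineOnShell

end
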